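import Summits.ResolutionOfSingularities.ResolutionOfSingularities.Theorems.WeightedInvariantLexMaxOrderDropOrder
import Summits.ResolutionOfSingularities.ResolutionOfSingularities.Theorems.WeightedInvariantContactCylinderGlobalMoveDictionary
import Summits.ResolutionOfSingularities.ResolutionOfSingularities.Theorems.WeightedInvariantHypersurfaceLocalGameEFTPointMoveChart
import HarnessLib

/-!
# Finiteness of the tie points, in-chart step (Wη): THE GLOBAL NO-DROP LOCUS HAS NO POINT OVER THE GENERIC POINT OF THE CURVE —
# door `HypersurfaceCentreConstruction` (stmt-ResolutionOfSingularities-19897), route `WeightedInvariant`, P3 rung `KeyRungGrLE 3 p`,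
# clause (c8)≤3,p for the letter `τ`

[OURS · L1 W4.3 · cell `res-hironaka`, HUMAN RULING D-0089] Helper file `--supports stmt-ResolutionOfSingularities-19897` (line
`local-engine` of res-L1-w43-plan-1, RULING gen 11 #5 / gen 12 #10 variant (V-AQS), spec `L/res-type-047/D2-INCHART-SPEC-v2.md` §1
step (Wη)).  SETTING: `A` a commutative ring (the affine ring of the chart), `P` a prime with `A_P` regular of dimension `2` (the generic
point `η` of the curve), `U = (y′, x′)` with `(U/1; (r, q); ℓ)` the LEX-MAXIMAL admissible weighted centre germ of `(f/1) ⊆ A_P`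
(Abramovich–Quek–Schober), `ℓ = r n`, `ord_{A_P}(f/1) = n ≥ 2`; `B = extReesAlgebra (weightedMonomialIdeal U (r, q))` the global move and
`f = (t⁻¹)^{rn} · G` in `B` with `t⁻¹ ∤ G`, the coefficients of `G` contracted at `P` (res-D-brk-1's `hcontr`, `…GlobalMoveContracted`).
CONCLUSION (`TieFinite.not_mem_pow_of_over_generic`): NO prime `𝔫` of `B` over `P` (`𝔫 ∩ A = P`) with `t⁻¹ ∈ 𝔫` off the vertex has
`G/1 ∈ 𝔪_{B_𝔫}ⁿ` — the no-drop locus `W` misses the fibre over `η`, the input `hWη` of `TieFinite.finite_image_comap_of_isConstructible`.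

Chain: `𝔫` misses `A ∖ P` (`ContactCylinder.disjoint_map_primeCompl_of_comap_eq`); res-D-brk-1's dictionary
`ContactCylinder.exists_ringHom_prime_ringEquiv_localMove'` (p538779) at `𝔮 := P` with the literal local move
`I' = weightedMonomialIdeal (U/1) (r, q)` gives `ψ`, `𝔫'`, `B_𝔫 ≃ B'_{𝔫'}`; at `𝔫'`: `t⁻¹ ∈ 𝔫'`, `𝔪_{A_P} B' ≤ 𝔫'`
(`map_algebraMap_le_iff_of_dictionary`), off the vertex (`exists_uT_not_mem` + `not_vertexIdeal_le_of_generator_not_mem`),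
`f/1 = (t⁻¹)^{rn} · ψ G` with `t⁻¹ ∤ ψ G` (`not_tInv_dvd_map_of_forall`); res-type-098's `LexMaxOrderDrop.adicOrder_transform_lt_of_isLexMax`
(AQS Thm 1.3 (3) at the two-dimensional `A_P`) gives `ord((ψ G)/1) < n`, while `G/1 ∈ 𝔪_𝔫ⁿ` would give `(ψ G)/1 ∈ 𝔪_{𝔫'}ⁿ`
(`mem_maximalIdeal_pow_iff_of_dictionary`, p542453).

[OURS] Replaces the role of NO printed item; NOT a statement of the manuscript under review [claim: Hironaka2017, status:
under-review].  AI work, weaker than expert review.  Def-free.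

## References

* D. Abramovich, M. H. Quek, B. Schober, arXiv:2507.01232 (v3, 2026), Thm 1.3 (3), §5. [AbramovichQuekSchober2025]
* J. Włodarczyk, *Functorial resolution except for toroidal locus. Toroidal compactification*, Def. 5.1.1. [Wlodarczyk2022]
-/

noncomputable section

set_option linter.dupNamespace false -- mandated namespace `Summit.<Summit>.<Problem>` of this single-conjunct summit

open IsLocalRing Literature.AlgebraicGeometry.Resolution LaurentPolynomial
open Summit.ResolutionOfSingularities.ResolutionOfSingularities.Theorems

namespace Summit.ResolutionOfSingularities.ResolutionOfSingularities.Cruxes.HypersurfaceCentreConstruction.LocalEngine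

namespace TieFinite

variable {A : Type} [CommRing A]

/-- **(Wη) THE NO-DROP LOCUS MISSES THE GENERIC POINT OF THE CURVE.**  With the data of the module docstring: for every prime `𝔫` of
the global move `B` with `t⁻¹ ∈ 𝔫`, off the vertex, and `𝔫 ∩ A = P`, the transform has `G/1 ∉ 𝔪_{B_𝔫}ⁿ`.
[cite: AbramovichQuekSchober2025, Thm 1.3 (3), §5] -/
theorem not_mem_pow_of_over_generic (P : Ideal A) [P.IsPrime] [IsRegularLocalRing (Localization.AtPrime P)]
    (hdimP : ringKrullDim (Localization.AtPrime P) = 2) {f : A} {n : ℕ} (hn : 2 ≤ n)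
    (hord : adicOrder (algebraMap A (Localization.AtPrime P) f) = (n : ℕ∞))
    (U : Fin 2 → A) {r q ℓ : ℕ}
    (hlex : IsLexMaxWeightedCentreGerm (Localization.AtPrime P)
      (Ideal.span {algebraMap A (Localization.AtPrime P) f}) (fun i => algebraMap A (Localization.AtPrime P) (U i)) ![r, q] ℓ)
    (hℓ : ℓ = r * n) {G : extReesAlgebra (weightedMonomialIdeal U ![r, q])}
    (hfg : algebraMap A (extReesAlgebra (weightedMonomialIdeal U ![r, q])) f =
      extReesAlgebra.tInv (weightedMonomialIdeal U ![r, q]) ^ (r * n) * G)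
    (hG : ¬ extReesAlgebra.tInv (weightedMonomialIdeal U ![r, q]) ∣ G)
    (hcontr : ∀ m : ℕ, algebraMap A (Localization.AtPrime P) ((G : A[T;T⁻¹]).coeff ((m : ℤ) - 1)) ∈
        weightedMonomialIdeal (fun i => algebraMap A (Localization.AtPrime P) (U i)) ![r, q] m →
      (G : A[T;T⁻¹]).coeff ((m : ℤ) - 1) ∈ weightedMonomialIdeal U ![r, q] m)
    (𝔫 : PrimeSpectrum (extReesAlgebra (weightedMonomialIdeal U ![r, q])))
    (hT : extReesAlgebra.tInv (weightedMonomialIdeal U ![r, q]) ∈ 𝔫.asIdeal)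
    (hV : ¬ extReesAlgebra.vertexIdeal (weightedMonomialIdeal U ![r, q]) ≤ 𝔫.asIdeal)
    (hcomap : 𝔫.asIdeal.comap (algebraMap A (extReesAlgebra (weightedMonomialIdeal U ![r, q]))) = P) :
    algebraMap _ (Localization.AtPrime 𝔫.asIdeal) G ∉ maximalIdeal (Localization.AtPrime 𝔫.asIdeal) ^ n := by
  classical
  intro hmem
  have hI' : ∀ m, weightedMonomialIdeal (fun i => algebraMap A (Localization.AtPrime P) (U i)) ![r, q] m =
      (weightedMonomialIdeal U ![r, q] m).map (algebraMap A (Localization.AtPrime P)) :=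
    fun m => (weightedMonomialIdeal_map _ U ![r, q] m).symm
  have hd := ContactCylinder.disjoint_map_primeCompl_of_comap_eq P 𝔫.asIdeal hcomap
  obtain ⟨ψ, 𝔫', h𝔫', g, hψc, hψa, hψt, hcomap', hg⟩ :=
    ContactCylinder.exists_ringHom_prime_ringEquiv_localMove' U ![r, q] P hI' 𝔫.asIdeal hd
  -- the successor `𝔫'` of the LOCAL move at `A_P`
  have hT' : extReesAlgebra.tInv (weightedMonomialIdeal (fun i => algebraMap A (Localization.AtPrime P) (U i)) ![r, q]) ∈ 𝔫' := by
    rw [← hψt]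
    exact (ContactCylinder.mem_iff_map_mem_of_comap_eq U ![r, q] P ψ hcomap' _).mp hT
  have hM' : (maximalIdeal (Localization.AtPrime P)).map (algebraMap (Localization.AtPrime P)
      (extReesAlgebra (weightedMonomialIdeal (fun i => algebraMap A (Localization.AtPrime P) (U i)) ![r, q]))) ≤ 𝔫' := by
    rw [← Localization.AtPrime.map_eq_maximalIdeal]
    refine (ContactCylinder.map_algebraMap_le_iff_of_dictionary U ![r, q] P ψ hψa hcomap' P).mp ?_
    rw [Ideal.map_le_iff_le_comap, hcomap]
  obtain ⟨i, hi⟩ := LocalGameEFTPointMove.exists_uT_not_mem U ![r, q] hV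
  have hWi : 0 < (![r, q] : Fin 2 → ℕ) i := hlex.2.1 i
  have hV' : ¬ extReesAlgebra.vertexIdeal
      (weightedMonomialIdeal (fun i => algebraMap A (Localization.AtPrime P) (U i)) ![r, q]) ≤ 𝔫' :=
    ContactCylinder.not_vertexIdeal_le_of_generator_not_mem U ![r, q] P hI' ψ hψc hcomap' hWi
      (LocalGameEFTPointMove.uT U ![r, q] i) (LocalGameEFTPointMove.coe_uT U ![r, q] i) hi
  have hfg' : algebraMap (Localization.AtPrime P)
      (extReesAlgebra (weightedMonomialIdeal (fun i => algebraMap A (Localization.AtPrime P) (U i)) ![r, q]))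
      (algebraMap A (Localization.AtPrime P) f) =
      extReesAlgebra.tInv _ ^ (r * n) * ψ G := by
    rw [← hψa, hfg, map_mul, map_pow, hψt]
  have hndvd' : ¬ extReesAlgebra.tInv
      (weightedMonomialIdeal (fun i => algebraMap A (Localization.AtPrime P) (U i)) ![r, q]) ∣ ψ G :=
    ContactCylinder.not_tInv_dvd_map_of_forall U ![r, q] P hI' ψ hψc G hG hcontr
  -- AQS Thm 1.3 (3) at `A_P` (res-type-098)
  have hℓ' : ℓ = (![r, q] : Fin 2 → ℕ) 0 * n := by rw [hℓ]; rfl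
  have hlt := LexMaxOrderDrop.adicOrder_transform_lt_of_isLexMax hdimP hlex hℓ' hn hord 𝔫' hT' hM' hV' (r * n) (ψ G)
    hfg' hndvd'
  -- but the order is transported along `g`
  have hmem' := (ContactCylinder.mem_maximalIdeal_pow_iff_of_dictionary ψ 𝔫.asIdeal 𝔫' g hg G n).mp hmem
  have hge : (n : ℕ∞) ≤ adicOrder (algebraMap _ (Localization.AtPrime 𝔫') (ψ G)) := by
    rw [le_adicOrder_iff]; exact hmem'
  exact absurd hlt (not_lt.mpr hge)

end TieFinite

end Summit.ResolutionOfSingularities.ResolutionOfSingularities.Cruxes.HypersurfaceCentreConstruction.LocalEngine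

end
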